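import Literature.IUT.LogThetaLattice.DHodgeTheaterNegSymmetry
import Literature.IUT.HodgeTheaters.PMBaseEx63ConsistencyProofs

/-!
# Non-vacuity witness for the `{±1}`-symmetry and the EXACT image of `†ℋ𝒯^{𝒟-Θ±ell} ↦ †𝔇_≻` ([IUTchI] Ex 6.2 (ii), 6.3 (ii), Def 6.4 (iii); [IUTchIII] Prop 1.3 (i), Rmk 1.3.1)

Mochizuki, *Inter-universal Teichmüller Theory I*, kurims manuscript (May 2020), §6, Def 6.1 (ii)–(vii) pp.156–159, Examples
6.2 (ii), 6.3 (ii) pp.160–161, Def 6.4 (iii) p.163; *III*, kurims (May 2020), Prop 1.3 (i) p.42, Rmk 1.3.1 p.43. PROOF-ONLY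
companion (theorems, no definitions) by the L6 cone prover abc-iut-w4-d017 to `DHodgeTheaterNegSymmetry.lean` (this seat,
p417794), over abc-iut-L5-t4's model kit `PMBaseKit.toyKit` and abc-iut-L5-t13's consistency theorem
`Ex63.equivariant_toyKit_of_isNegative` / `Ex63.negCompat_toyKit` (`PMBaseEx63ConsistencyProofs.lean`: the hypothesis `hE`
— equivariance of [IUTchI] Ex 6.3 (ii) for negative elements — HOLDS at the model kit). DAG nodes IUTchIII:Prop1.3(i) /
IUTchIII:Thm1.5(i). ([IUTchI] Def 6.4 (iii) p.163) [claim: Mochizuki2012, status: disputed].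

p417794 characterises, GIVEN `hE`, the image of `Isom(†ℋ𝒯, ‡ℋ𝒯) → Isom(†𝔇_≻, ‡𝔇_≻)` as exactly the two `±`-synchronized
`+`-full poly-isomorphisms. This file shows the characterisation is NON-VACUOUS and SHARP in the tree: over the genuine
TWO-place model kit obtained by pulling `toyKit` back along `Bool → Unit` (built inside the proof, no new definition —
as in `DHodgeTheaterSignSynchronizationWitness.lean`), `hE` HOLDS (transport of abc-iut-L5-t13's `negCompat_toyKit`), so for
the model Hodge theater `Ex62.ht`:
* `DHTRep.DRepIso.exists_kit_negative_and_not_surjective` — a representative automorphism NEGATIVE at every `†𝒟_{≻,v}`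
  EXISTS (the `{±1}`-symmetry is realised), AND `Isom → Isom(†𝔇_≻, †𝔇_≻)` is NOT surjective (two places): both synchronized
  classes occur, the mixed ones do not;
* `DHTRep.DRepIso.exists_kit_image_exact` — the exact-image statement `exists_cod_eq_iff_sync` holds there UNCONDITIONALLY.
HONEST FRAMING: a consistency/non-vacuity witness over a toy model of the typed interface; nothing here bears on
[IUTchIII] Cor 3.12; typed ≠ proved for the series' claims; no side taken.
-/

namespace Literature.IUT.LogThetaLattice

open CategoryTheory
open Literature.IUT.HodgeTheaters Literature.IUT.HodgeTheaters.PMBaseKit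

namespace DHTRep

namespace DRepIso

/-- **IUTchI:Ex6.3(ii)** (kurims p.161) Over the TWO-place pull-back of abc-iut-L5-t4's model kit (along `Bool → Unit`, built inside the
proof), the equivariance `hE` of Example 6.3 (ii) for negative elements HOLDS (abc-iut-L5-t13's `Ex63.negCompat_toyKit`
transported verbatim, then `Ex63.equivariant_of_negCompat`); hence for the model `𝒟-Θ^{±ell}`-Hodge theater `Ex62.ht`: a
representative automorphism NEGATIVE at every `†𝒟_{≻,v}` exists (p417794 `exists_forall_labMap_cod_ne_refl` — the
`{±1}`-symmetry of Ex 6.2 (ii) is realised) AND the strip projection on automorphisms is not surjective (p417155, `v ≠ w`):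
both `±`-synchronized classes occur, the mixed ones do not. ([IUTchI] Ex 6.3 (ii) p.161) [claim: Mochizuki2012, status: disputed] -/
theorem exists_kit_negative_and_not_surjective (l : ℕ) [Fact l.Prime] (hl : l ≠ 2) :
    ∃ (K : PMBaseKit.{0} l) (v w : K.V) (_ : v ≠ w) (H : K.DThetaPMEllHT),
      (∀ γ : FlPM l, γ.IsNegative → Ex63.Equivariant K γ) ∧
      (∃ a : DRepIso H H, ∀ u, K.labMap u (a.cod u) ≠ Equiv.refl _) ∧
      ¬ Function.Surjective (fun f : DRepIso H H => f.cod) := by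
  haveI : NeZero l := ⟨(Fact.out : l.Prime).ne_zero⟩
  let K₁ := PMBaseKit.toyKit l hl
  let K : PMBaseKit.{0} l :=
    { V := Bool
      bad := ∅
      arc := ∅
      Amb := fun _ => K₁.Amb ()
      model := fun _ => K₁.model ()
      pmObj := fun _ => K₁.pmObj ()
      toPM := fun _ => K₁.toPM ()
      LabCuspPM := fun _ => K₁.LabCuspPM ()
      labPM := fun _ => K₁.labPM ()
      labMap := fun _ => K₁.labMap ()
      labMap_refl := fun _ => K₁.labMap_refl ()
      labMap_trans := fun _ => K₁.labMap_trans ()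
      labMap_charts := fun _ => K₁.labMap_charts ()
      exists_negative := fun _ => K₁.exists_negative ()
      Glob := K₁.Glob
      gModel := K₁.gModel
      gIso := K₁.gIso
      GLab := K₁.GLab
      gLabMap := K₁.gLabMap
      gLabMap_refl := K₁.gLabMap_refl
      gLabMap_trans := K₁.gLabMap_trans
      toFlStar := K₁.toFlStar
      toFlStar_surjective := K₁.toFlStar_surjective
      gLabT := K₁.gLabT
      gChart₀ := K₁.gChart₀
      gChart₀_mem := K₁.gChart₀_mem
      autCsp_le := K₁.autCsp_le
      gLab_range := K₁.gLab_range
      atV := fun _ => K₁.atV ()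
      phiEll := fun _ => K₁.phiEll ()
      labOfHom := fun _ => K₁.labOfHom ()
      labOfHom_pre := fun _ => K₁.labOfHom_pre ()
      labOfHom_post := fun _ => K₁.labOfHom_post ()
      labOfHom_phiEll_bijective := fun _ => K₁.labOfHom_phiEll_bijective ()
      labOfHom_phiEll_charts := fun _ => K₁.labOfHom_phiEll_charts () }
  have hE : ∀ γ : FlPM l, γ.IsNegative → Ex63.Equivariant K γ := fun γ hγ =>
    Ex63.equivariant_of_negCompat (K := K) (fun _ => Ex63.negCompat_toyKit l hl ()) hγ
  exact ⟨K, false, true, Bool.false_ne_true, Ex62.ht K, hE,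
    exists_forall_labMap_cod_ne_refl hE ⟨false⟩ (Ex62.ht K),
    cod_not_surjective (Ex62.ht K) (Ex62.ht K) Bool.false_ne_true⟩

/-- **IUTchIII:Prop1.3(i)** (kurims p.42) **The exact-image characterisation of p417794 holds UNCONDITIONALLY at a tree model**: there is
a two-place kit and a `𝒟-Θ^{±ell}`-Hodge theater over it for which `δ : †𝔇_≻ ⥲ †𝔇_≻` is the `≻`-constituent of a representative
automorphism IFF its sign relative to the identity representative is `v`-independent — and BOTH signs occur while mixed
signs do not (previous theorem), so the two `±`-synchronized `+`-full poly-automorphisms of Def 6.1 (iv) are exactly the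
induced ones ([IUTchIII] Rmk 1.3.1 «±-synchronization», kernel form, non-vacuous).
([IUTchIII] Prop 1.3 (i) p.42) [claim: Mochizuki2012, status: disputed] -/
theorem exists_kit_image_exact (l : ℕ) [Fact l.Prime] (hl : l ≠ 2) :
    ∃ (K : PMBaseKit.{0} l) (v w : K.V) (_ : v ≠ w) (H : K.DThetaPMEllHT),
      (∃ a : DRepIso H H, ∀ u, K.labMap u (a.cod u) ≠ Equiv.refl _) ∧
      ∀ δ : H.codomain.Iso H.codomain,
        (∃ g : DRepIso H H, g.cod = δ) ↔
          ∀ u u', (K.labMap u (((DRepIso.refl H).cod u).symm ≪≫ δ u) = Equiv.refl _ ↔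
            K.labMap u' (((DRepIso.refl H).cod u').symm ≪≫ δ u') = Equiv.refl _) := by
  obtain ⟨K, v, w, hvw, H, hE, hneg, -⟩ := exists_kit_negative_and_not_surjective l hl
  exact ⟨K, v, w, hvw, H, hneg, fun δ => exists_cod_eq_iff_sync hE (DRepIso.refl H) δ⟩

end DRepIso

end DHTRep

end Literature.IUT.LogThetaLattice
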